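import Mathlib
import HarnessLib

/-!
# Route `JensenLogBand` (rung J-P (P3), the TERMINAL RH-free rung of the Jensen column) — the real-arithmetic support
# `LogBandArith`: a log band `d + 1 ≤ e^{c'n}` sits inside the wide band `2d + (1+√n)√(2d) ≤ e^{cn}` for any `c' < c`

**RH-FREE, ξ-free, pure real arithmetic.** The glue of theory g9's route «JensenLogBand» (leaf `JensenLogBandEighth`:
`∀ C > 1/8 ∃ n₁ ∀ d n, n ≥ n₁ → C·log(d+1) ≤ n → J^{d,n}_γ hyperbolic`) feeds the zero-side window
`XiDerivNonrealZeroBeyond (n ↦ e^{cn})` (all non-real zeros of `ξ₁⁽ⁿ⁾` beyond `e^{cn}`) into the WIDE BAND of the Jensen-chain /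
Kim–Lee sector theorem (`JensenWideBandBelow`: hyperbolic as soon as `2d + (1+√n)·√(2d) ≤ R(n)`, tree `KimLee.wideBand_of_beyond`).
The arithmetic step between the two shapes is this file:

* `wideBand_le_exp_of_succ_le_exp` — for `c' < c`, `n ≥ 2`, `n ≥ 8/(c−c')²` and `d + 1 ≤ e^{c'n}`:
  `2d + (1+√n)·√(2d) ≤ e^{cn}` (explicit threshold; proof: `d = 0` trivial; else `E := e^{c'n} ≥ 2`, `√(2d) ≤ √(2E) ≤ E`,
  `1 + √n ≤ 1 + n`, so the left side is `≤ (3+n)E`, and `e^{(c−c')n} ≥ 1 + δn + (δn)²/2 ≥ 3 + n`);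
* `logBandArith` — the `∃ n₀ ∀ d n ≥ n₀` form (theory g9's 2026-08-26T22:21:45Z wording of the support item `LogBandArith`),
  witness `n₀ = ⌈8/(c−c')²⌉₊ + 2`.

(An independent draft of the same lemma by rh-jensen-eng g6, `HOME/eng/g6/LogBandArith.lean`, uses the witness `max 2 ⌈8/(c−c')²⌉₊`;
this file is the claimant's version.) WHAT THIS IS NOT: nothing here bears on zeros of `ζ` or the truth of RH; no hyperbolicity
statement is proved here.
-/

noncomputable section
-- D-0017: `Summit.RiemannHypothesis.RiemannHypothesis.…` duplicates the namespace BY DESIGN (single-problem summit).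
set_option linter.dupNamespace false

namespace Summit.RiemannHypothesis.RiemannHypothesis.Theorems.JensenPolynomials.LogBand

/-- `√n ≤ n` for a natural number `n` (as reals). -/
theorem sqrt_natCast_le (n : ℕ) : Real.sqrt n ≤ (n : ℝ) := by
  rw [Real.sqrt_le_left (by positivity)]
  exact_mod_cast (by simpa [sq] using Nat.le_mul_self n)

/-- For `E ≥ 2`: `√(2E) ≤ E`. -/
theorem sqrt_two_mul_le_self {E : ℝ} (hE : 2 ≤ E) : Real.sqrt (2 * E) ≤ E := by
  rw [Real.sqrt_le_left (by linarith)]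
  nlinarith

/-- For `δ > 0`, `n ≥ 8/δ²` and `n ≥ 2`: `3 + n ≤ e^{δ n}` (from `e^x ≥ 1 + x + x²/2`). -/
theorem three_add_le_exp {δ : ℝ} (hδ : 0 < δ) {n : ℝ} (hn : 8 / δ ^ 2 ≤ n) (hn2 : 2 ≤ n) :
    3 + n ≤ Real.exp (δ * n) := by
  have hx : 0 ≤ δ * n := by positivity
  have hq := Real.quadratic_le_exp_of_nonneg hx
  have hδ2 : 0 < δ ^ 2 := by positivity
  have h8 : 8 ≤ δ ^ 2 * n := by
    have := mul_le_mul_of_nonneg_left hn hδ2.le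
    rwa [mul_div_cancel₀ _ hδ2.ne'] at this
  have hsq : n + 2 ≤ (δ * n) ^ 2 / 2 := by nlinarith
  nlinarith

/-- **`LogBandArith`, explicit threshold (RH-FREE).** For `c' < c`, `n ≥ 2`, `n ≥ 8/(c − c')²` and
`d + 1 ≤ e^{c'n}`: `2d + (1 + √n)·√(2d) ≤ e^{cn}`. -/
theorem wideBand_le_exp_of_succ_le_exp {c c' : ℝ} (hcc : c' < c) {n : ℕ} (hn2 : 2 ≤ n)
    (hn : 8 / (c - c') ^ 2 ≤ n) {d : ℕ} (hd : (d : ℝ) + 1 ≤ Real.exp (c' * n)) :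
    2 * (d : ℝ) + (1 + Real.sqrt n) * Real.sqrt (2 * d) ≤ Real.exp (c * n) := by
  set δ : ℝ := c - c' with hδdef
  have hδ : 0 < δ := by rw [hδdef]; linarith
  have hn2' : (2 : ℝ) ≤ n := by exact_mod_cast hn2
  have hsplit : Real.exp (c * n) = Real.exp (c' * n) * Real.exp (δ * n) := by
    rw [← Real.exp_add]; congr 1; rw [hδdef]; ring
  rcases Nat.eq_zero_or_pos d with rfl | hd1
  · simp only [Nat.cast_zero, mul_zero, Real.sqrt_zero, zero_add]
    exact (Real.exp_pos _).le
  · set E : ℝ := Real.exp (c' * n) with hE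
    have hE2 : 2 ≤ E := by
      have : (1 : ℝ) ≤ d := by exact_mod_cast hd1
      linarith
    have hE0 : 0 ≤ E := by linarith
    have hsd : Real.sqrt (2 * d) ≤ E :=
      (Real.sqrt_le_sqrt (by linarith)).trans (sqrt_two_mul_le_self hE2)
    have hsn : 1 + Real.sqrt n ≤ 1 + n := by linarith [sqrt_natCast_le n]
    have hLHS : 2 * (d : ℝ) + (1 + Real.sqrt n) * Real.sqrt (2 * d) ≤ (3 + n) * E := by
      have h1 : (1 + Real.sqrt n) * Real.sqrt (2 * d) ≤ (1 + n) * E :=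
        mul_le_mul hsn hsd (Real.sqrt_nonneg _) (by positivity)
      nlinarith
    have hexp : 3 + (n : ℝ) ≤ Real.exp (δ * n) := three_add_le_exp hδ hn hn2'
    calc 2 * (d : ℝ) + (1 + Real.sqrt n) * Real.sqrt (2 * d) ≤ (3 + n) * E := hLHS
      _ ≤ Real.exp (δ * n) * E := mul_le_mul_of_nonneg_right hexp hE0
      _ = Real.exp (c * n) := by rw [hsplit, mul_comm]

/-- **`LogBandArith` (RH-FREE; theory g9's wording of the support item of route «JensenLogBand»):**
`c' < c ⇒ ∃ n₀, ∀ d n, n₀ ≤ n → d + 1 ≤ e^{c'n} → 2d + (1+√n)·√(2d) ≤ e^{cn}`, with the witness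
`n₀ = ⌈8/(c−c')²⌉₊ + 2`. -/
theorem logBandArith (c c' : ℝ) (hcc : c' < c) :
    ∃ n₀ : ℕ, ∀ d n : ℕ, n₀ ≤ n → (d : ℝ) + 1 ≤ Real.exp (c' * n) →
      2 * (d : ℝ) + (1 + Real.sqrt n) * Real.sqrt (2 * d) ≤ Real.exp (c * n) := by
  refine ⟨⌈8 / (c - c') ^ 2⌉₊ + 2, fun d n hn hd => ?_⟩
  have hn' : (⌈8 / (c - c') ^ 2⌉₊ : ℝ) + 2 ≤ n := by exact_mod_cast hn
  have hceil : 8 / (c - c') ^ 2 ≤ (⌈8 / (c - c') ^ 2⌉₊ : ℝ) := Nat.le_ceil _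
  have h0 : (0 : ℝ) ≤ ⌈8 / (c - c') ^ 2⌉₊ := Nat.cast_nonneg _
  exact wideBand_le_exp_of_succ_le_exp hcc (by exact_mod_cast (by omega : 2 ≤ n)) (by linarith) hd

/-- **The window-to-band threshold, uniform form (RH-FREE):** for `c' < c` there is `n₀` such that for all `n ≥ n₀` and
all `d` with `d + 1 ≤ e^{c'n}`, also `2d + (1+√n)√(2d) ≤ e^{cn}` — `logBandArith` with the quantifiers in the order
`∀ n ≥ n₀, ∀ d` (the shape `KimLee.wideBand_of_beyond` consumes). -/
theorem logBandArith' (c c' : ℝ) (hcc : c' < c) :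
    ∃ n₀ : ℕ, ∀ n : ℕ, n₀ ≤ n → ∀ d : ℕ, (d : ℝ) + 1 ≤ Real.exp (c' * n) →
      2 * (d : ℝ) + (1 + Real.sqrt n) * Real.sqrt (2 * d) ≤ Real.exp (c * n) := by
  obtain ⟨n₀, h⟩ := logBandArith c c' hcc
  exact ⟨n₀, fun n hn d hd => h d n hn hd⟩

end Summit.RiemannHypothesis.RiemannHypothesis.Theorems.JensenPolynomials.LogBand

end
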